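import Mathlib.AlgebraicGeometry.Morphisms.Smooth
import Mathlib.AlgebraicGeometry.Morphisms.ClosedImmersion
import Mathlib.AlgebraicGeometry.Morphisms.Proper
import Mathlib.AlgebraicGeometry.Morphisms.UnderlyingMap
import Mathlib.AlgebraicGeometry.Limits
import Mathlib.Topology.Connected.Clopen
import Literature.AlgebraicGeometry.Resolution.ResolutionOfSingularities
import Literature.AlgebraicGeometry.Morphisms.ProjectiveMorphism
import Mathlib.Data.ZMod.Basic
import HarnessLib

/-!
# Hu 2025 (arXiv:2507.21400v1, Part I), §8.4 — «smooth» (Def. 8.4) and «admits a resolution»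
# (p.158, before Thm. 8.6): the INTERFACE I-SM of PARTITION-HU row 110, STATEMENTS-FIRST
# (LADDER-RESOLUTION rung M-Hu-min, D-0089; file `R110aSmooth`, sub-dir `S08MainTheorem`)

**Status of the source (D-0012): UNREFEREED PREPRINT UNDER ADJUDICATION.** Y. Hu, *Universal
characteristic-free resolution of singularities, I*, arXiv:2507.21400v1 (2025-07-29), 162 pp.
[Hu2025] (lit key `paper:arxiv-2507.21400` = TeX-source chunks `p0001…p0073.txt`; PDF of record
`HOME/lit/res-lit-6/hu/hu2025_2507.21400v1.pdf`, page renders `hu25_p156.png`, `hu25_p158.png`,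
`hu25_p017.png`, `hu25_p003.png` READ by the typer). NOTHING from the preprint is asserted in this
file: the two printed DEFINITIONS («smooth», «admits a resolution») are transcribed as real Lean
predicates over Mathlib's scheme library, to be CONSUMED by the candidate statements Thm 8.5 / 8.6 /
1.3 / 1.1 (row 110 files `b`/`c`), which are `def … : Prop` tagged `[claim: Hu2025, status:
under-review]`. No proofs, no `sorry`, no `instance`, no notation.
STATUS: candidate statements under adjudication (D-0012/D-0089); not asserted.

HONEST CEILING (PARTITION-HU header, verbatim): Part I as printed claims resolution of singularity
TYPES (Thm 1.1: a smooth cover `Y → X` and `Ỹ → Y`); the summit-type claim ([Hu22] Thm 1.1, perfect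
`k`, «`X` admits a resolution») rests on the UNPOSTED Part II. AI typing/adjudication is weaker than
expert review.

LOCATORS (PARTITION-HU §0 grammar): `chunk p<cc> l.<a>–<b>` = lines of the held TeX-chunk text (the
locator of record; decl-name anchors `C<cc>L<l>`), and next to it the arXiv-v1 PDF page `p.<N>`
with the printed line read on the page render (running head excluded).

## Transcription (preprint ↔ this file)

* Def. 8.4, chunk p0070 l.74–76; p.156 L004–L005: «A scheme `X` is smooth if it is a disjoint union of
  finitely many connected smooth schemes of possibly various dimensions.» (printed verbatim a
  second time in §1.6, chunk p0008 l.100–102; p.17 L006–L007: «In this article, a scheme `X` is smooth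
  if …») → `HuSmooth` (AS PRINTED: a finite coproduct decomposition into connected pieces, each
  smooth OVER THE BASE) = `Def8_4` = `C08L100`; sibling `HuSmooth_ours` (the same property in
  Mathlib's idiom: `Smooth g ∧` finitely many connected components).
* chunk p0071 l.67–69; p.158 L021–L024: «Let `X` be an integral scheme. We say `X` admits a resolution
  if there exists a smooth scheme `X̃` and a projective birational morphism from `X̃` onto `X`.»
  → `IsHuResolution π g` (the printed requirements on the morphism `π : X̃ → X`) and
  `AdmitsResolution g` = `C71L67` (∃ such a `π`).
* Thm 1.1, chunk p0003 l.9–10 and l.18–19; p.3 L014–L015 and L019–L020: «… there exists a smooth morphism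
  `Y → X` from a scheme `Y` onto `X`, a smooth scheme `Ỹ` and a surjective proper birational morphism
  `Ỹ → Y`. … In such a case, we say `X` admits a resolution of singularity type.» →
  `AdmitsResolutionType g` = `C03L19` (the display (1.1) `Ỹ ⟶ Y ⟶ X`). Thm 1.1 itself (its
  hypotheses «integral affine scheme of finite presentation over a perfect field defined over `ℤ`»,
  «singular») is row 110 file `b`, not this interface.

* §8 preamble, chunk p0067 l.3–8; p.147 L048–L050: «Let `p` be an arbitrarily fixed prime number. Let `𝔽` be
  either `ℚ` or a finite field with `p` elements. In this entire section, every scheme is defined over `ℤ`, consequently,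
  is defined over `𝔽`, and is considered as a scheme over the perfect field `𝔽`.» (= the first sentence of Thm 1.3,
  chunk p0008 l.108–110) → `IsHuBaseField 𝔽` = `C67L4` (a PROPERTY of the field; PARTITION-HU §6 (c)).
* «singular» (Thm 8.6 chunk p0071 l.88–89; Thm 1.3 chunk p0008 l.115–116; Thm 1.1 chunk p0003 l.8; [Hu22] Thm 1.1) is
  never defined in print → two READINGS `HuSingular g` (¬ smooth over the base) / `HuSingular_reg X` (¬ regular).
  (v3 of this interface, 2026-08-27T05:3xZ: these four decls moved here from file b so that files b and c depend on no
  other row.)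

## Rendering choices (for the faithfulness lanes; each is a choice, none takes a side)

* THE BASE OF «SMOOTH». Def. 8.4 prints «smooth» with no base; every USE prints one («smooth over
  `Spec 𝔽`» Thm 8.5, chunk p0070 l.83–87; «smooth over `𝔽`» Thm 1.3, chunk p0008 l.113; `Z_Γ`,
  `Z̃_{ℓ,Γ}` «are considered as `𝔽`-schemes», chunk p0070 l.93). Mathlib's smoothness is a property
  of a MORPHISM (`AlgebraicGeometry.Smooth`), so every predicate here takes the structure morphism
  `g : X ⟶ S` as an explicit argument; row 110 instantiates `S = Spec 𝔽` (Thm 8.5/8.6/1.3) resp.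
  `S = Spec k` (Thm 1.1). The absolute reading «smooth over `Spec ℤ`» is NOT typed: a non-empty
  scheme of characteristic `p` is never smooth over `ℤ` (not flat), so that reading would make
  Thm 8.5 refutable for `𝔽 = 𝔽_p` for a reason foreign to the text — recorded here so that the lanes
  see the choice.
* «disjoint union of finitely many connected smooth schemes» = an isomorphism `∐ᵢ Yᵢ ≅ X` from the
  scheme-theoretic coproduct (Mathlib `Sigma.ι`, `∐`) of a FINITE family, each `Yᵢ` connected
  (Mathlib `ConnectedSpace`: non-empty and preconnected; the empty scheme is the empty coproduct)
  and smooth over `S` through `X`. «of possibly various dimensions» imposes nothing and is not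
  rendered. `HuSmooth_ours` (`Smooth g ∧ Finite (ConnectedComponents X)`) is the usual phrasing;
  the equivalence (connected components of a space with finitely many of them are clopen) is NOT
  proved here (S file: no proofs) — an OURS sibling, labelled, never substituted silently.
* «projective morphism» (p.158 L023; Thm 8.6 «surjective, projective, and birational», chunk p0071
  l.87): Hartshorne's definition (II §4, p.103: `π` factors as a closed immersion `X̃ ↪ ℙⁿ_X`
  followed by the projection) = Stacks 01W8 «H-projective», rendered with the tree's projective
  space over a scheme `Literature.AlgebraicGeometry.Morphisms.projectiveSpace ι X = X ×_ℤ ℙ^{#ι}_ℤ`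
  (AffineSpaceCompactification.lean): the tree's `Literature.AlgebraicGeometry.Morphisms.IsProjective`
  (ProjectiveMorphism.lean, p492803: closed immersion into `ℙ(ι; X)` followed by the projection; projective ⇒ proper)
  — Mathlib has no projective morphisms; the tree's `Crystalline.IsProjectiveOverRing` /
  `Motives.IsProjectiveOver` need an affine/field base. The EGA notion (closed immersion into
  `ℙ(𝓔)` for a quasi-coherent `𝒪_X`-module of finite type) is weaker over a general base and agrees
  with this one over an affine base such as `Z_Γ`; not typed.
* «birational» = the tree's `Resolution.IsBirational` (isomorphism over a dense open with dense
  preimage; Stacks 01RN), the reading used by the summit statement `Resolution.ResolutionInChar`.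
  «onto» / «surjective» = Mathlib `AlgebraicGeometry.Surjective`. «proper» (Thm 1.1) = Mathlib
  `IsProper`.
* «Let `X` be an integral scheme» (p.158 L021) is the SCOPE in which the phrase is introduced; the
  definiens does not use integrality, so `AdmitsResolution` is typed for every `g : X ⟶ S` and the
  consumers (Thm 8.6, Thm 1.1, [Hu22] Thm 1.1) carry `IsIntegral X` as their own explicit hypothesis
  (T4). Likewise «singular» (Thm 8.6 «if `Z_Γ` is singular», Thm 1.1 «Assume further that `X` is
  singular») is the consumers' hypothesis; the text never defines it — row 110 `b` chooses the
  reading (¬ smooth over the base / ¬ regular) and says so.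
* Tree cross-reference (not restated, not compared here): the summit's `Resolution.Scheme.HasResolution`
  asks for a PROPER birational `π` with REGULAR source and no surjectivity clause; Hu's phrase asks
  for PROJECTIVE, birational, surjective, with source SMOOTH OVER THE BASE. Any implication between
  the two (projective ⇒ proper; smooth over a field ⇒ regular; regular ⇏ smooth over an imperfect
  field — tree barrier `Barriers.ResolutionOfSingularities.RegularNotGeometricallyRegular`) is rung-B
  business under `Summits/`, not this file's.

## Sources

* Y. Hu, arXiv:2507.21400v1 (2025): Def. 8.4 (chunk p0070 l.74–76; p.156), §1.6 (chunk p0008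
  l.100–102; p.17), p.158 L021–L024 (chunk p0071 l.67–69), Thm 1.1 (chunk p0003 l.3–19; p.3).
  [Hu2025] (ADJUDICATED, not cited as fact)
* R. Hartshorne, *Algebraic Geometry* (1977), II §4, Def. p.103 (projective morphism). [Hartshorne1977]
* The Stacks Project, Tag 01W8 (H-projective), Tag 01RN (birational). [StacksProject]
-/

noncomputable section

open _root_.CategoryTheory _root_.CategoryTheory.Limits _root_.AlgebraicGeometry
  _root_.TopologicalSpace

namespace Literature.AlgebraicGeometry.Hu2025.Statements.S08MainTheorem

open Literature.AlgebraicGeometry.Resolution Literature.AlgebraicGeometry.Morphisms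

universe u

/-! ## Def. 8.4 (chunk p0070 l.74–76; p.156) = §1.6 (chunk p0008 l.100–102; p.17) — «smooth» -/

/-- **Hu 2025, Def. 8.4** (chunk p0070 l.74–76; PDF p.156 L004–L005), verbatim: «A scheme `X` is smooth
if it is a disjoint union of finitely many connected smooth schemes of possibly various dimensions.»
(printed identically in §1.6, chunk p0008 l.100–102; p.17 L006–L007). AS PRINTED, relative to the base
`g : X ⟶ S` that every use of the word supplies («smooth over `Spec 𝔽`», Thm 8.5; see the module
docstring, THE BASE OF «SMOOTH»): there are a finite index type `ι`, schemes `Y i`, and an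
isomorphism `∐ᵢ Y i ≅ X` from their scheme-theoretic disjoint union, such that every `Y i` is
connected and smooth over `S` (Mathlib `AlgebraicGeometry.Smooth` of `Y i → ∐ Y ≅ X → S`).
Sibling in Mathlib's idiom: `HuSmooth_ours`. [claim: Hu2025, status: under-review]
STATUS: candidate statement under adjudication (D-0012/D-0089); not asserted. -/
def HuSmooth {X S : Scheme.{u}} (g : X ⟶ S) : Prop :=
  ∃ (ι : Type u) (_ : Finite ι) (Y : ι → Scheme.{u}) (e : (∐ Y) ≅ X),
    ∀ i : ι, ConnectedSpace ↥(Y i) ∧ _root_.AlgebraicGeometry.Smooth (Sigma.ι Y i ≫ e.hom ≫ g)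

/-- **Hu 2025, Def. 8.4** — numbered alias of `HuSmooth` (chunk p0070 l.74–76; p.156 L004–L005).
[claim: Hu2025, status: under-review]
STATUS: candidate statement under adjudication (D-0012/D-0089); not asserted. -/
abbrev Def8_4 {X S : Scheme.{u}} (g : X ⟶ S) : Prop := HuSmooth g

/-- **Hu 2025, §1.6** (chunk p0008 l.100–102; PDF p.17 L006–L007), verbatim: «In this article, a scheme
`X` is smooth if it is a disjoint union of finitely many connected smooth schemes of possibly various
dimensions.» — the introduction's copy of Def. 8.4; alias of `HuSmooth` (anchor `C08L100`).
[claim: Hu2025, status: under-review]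
STATUS: candidate statement under adjudication (D-0012/D-0089); not asserted. -/
abbrev C08L100 {X S : Scheme.{u}} (g : X ⟶ S) : Prop := HuSmooth g

/-- **Def. 8.4, READING OURS** (labelled sibling, T5/§6 (e); chunk p0070 l.74–76; p.156 L004–L005): in
Mathlib's idiom «`X` is a disjoint union of finitely many connected smooth schemes [over `S`]» reads
«`g : X → S` is smooth and `X` has finitely many connected components» (a space with finitely many
connected components is the disjoint union of them, each clopen; smoothness is local on the source).
The equivalence with `HuSmooth` is NOT proved in this statements file. For `X` quasi-compact and
`g` smooth over a field, `X` is Noetherian and the finiteness clause is automatic — not used here.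
[claim: Hu2025, status: under-review]
STATUS: candidate statement under adjudication (D-0012/D-0089); not asserted. -/
def HuSmooth_ours {X S : Scheme.{u}} (g : X ⟶ S) : Prop :=
  _root_.AlgebraicGeometry.Smooth g ∧ Finite (ConnectedComponents ↥X)

/-! ## p.158 L021–L024 (chunk p0071 l.67–69) — «admits a resolution» -/

/-- **Hu 2025, p.158 L021–L024** (chunk p0071 l.67–69), the requirements printed on the morphism:
«… a smooth scheme `X̃` and a projective birational morphism from `X̃` onto `X`» — for
`π : X̃ ⟶ X` over the base `g : X ⟶ S`: `X̃` is smooth in the sense of Def. 8.4 over `S` (via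
`π ≫ g`), `π` is projective (tree `Morphisms.IsProjective`, Hartshorne II §4), birational (tree
`Resolution.IsBirational`, Stacks 01RN) and onto (Mathlib `Surjective`). This is also how the text
uses «`π` is a resolution» (Thm 8.6, chunk p0071 l.88–89: «`Z̃†_{ℓ,Γ} → Z_Γ` is a resolution if
`Z_Γ` is singular»; Thm 1.3, chunk p0008 l.115–116). [claim: Hu2025, status: under-review]
STATUS: candidate statement under adjudication (D-0012/D-0089); not asserted. -/
def IsHuResolution {Xt X S : Scheme.{u}} (π : Xt ⟶ X) (g : X ⟶ S) : Prop :=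
  HuSmooth (π ≫ g) ∧ IsProjective π ∧ IsBirational π ∧
    _root_.AlgebraicGeometry.Surjective π

/-- **Hu 2025, p.158 L021–L024** (chunk p0071 l.67–69), verbatim: «Let `X` be an integral scheme. We
say `X` admits a resolution if there exists a smooth scheme `X̃` and a projective birational morphism
from `X̃` onto `X`.» For `g : X ⟶ S` (the base over which «smooth» is read, see Def. 8.4):
`∃ X̃ (π : X̃ ⟶ X), IsHuResolution π g`. The printed scope «`X` integral» is carried by the consumers
(Thm 8.6, Thm 1.1, [Hu22] Thm 1.1) as their hypothesis `IsIntegral X`; the definiens does not use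
it. NOT the summit's `Resolution.Scheme.HasResolution` (proper, birational, regular source) — see
the module docstring; no comparison is made here. [claim: Hu2025, status: under-review]
STATUS: candidate statement under adjudication (D-0012/D-0089); not asserted. -/
def AdmitsResolution {X S : Scheme.{u}} (g : X ⟶ S) : Prop :=
  ∃ (Xt : Scheme.{u}) (π : Xt ⟶ X), IsHuResolution π g

/-- **Hu 2025, p.158 L021–L024** — anchor alias `C71L67` of `AdmitsResolution` (chunk p0071 l.67–69).
[claim: Hu2025, status: under-review]
STATUS: candidate statement under adjudication (D-0012/D-0089); not asserted. -/
abbrev C71L67 {X S : Scheme.{u}} (g : X ⟶ S) : Prop := AdmitsResolution g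

/-! ## Thm 1.1's phrase (chunk p0003 l.9–19; p.3) — «admits a resolution of singularity type» -/

/-- **Hu 2025, §1, display (1.1) and the sentence after it** (chunk p0003 l.9–19; PDF p.3 L014–L020),
verbatim: «there exists a smooth morphism `Y → X` from a scheme `Y` onto `X`, a smooth scheme `Ỹ`
and a surjective proper birational morphism `Ỹ → Y`. Put it in display, we have two surjective
morphisms `Ỹ ⟶ Y ⟶ X` such that the first is proper birational and the second is smooth. In such a
case, we say `X` admits a resolution of singularity type.» For `g : X ⟶ S` (the base over which the
smoothness of the SCHEME `Ỹ` is read, Def. 8.4; in Thm 1.1 `S = Spec k`, `k` the perfect field):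
`∃ Y (φ : Y ⟶ X) Ỹ (ψ : Ỹ ⟶ Y)`, `φ` smooth (Mathlib `Smooth φ`, a property of the MORPHISM) and
onto, `Ỹ` smooth over `S` via `ψ ≫ φ ≫ g` (`HuSmooth`), `ψ` surjective, proper (Mathlib `IsProper`)
and birational (`Resolution.IsBirational`). Note the print asks «proper» here and «projective» on
p.158. The hypotheses of Thm 1.1 on `X` are NOT part of this phrase (row 110 `b`).
[claim: Hu2025, status: under-review]
STATUS: candidate statement under adjudication (D-0012/D-0089); not asserted. -/
def AdmitsResolutionType {X S : Scheme.{u}} (g : X ⟶ S) : Prop :=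
  ∃ (Y : Scheme.{u}) (φ : Y ⟶ X) (Yt : Scheme.{u}) (ψ : Yt ⟶ Y),
    _root_.AlgebraicGeometry.Smooth φ ∧ _root_.AlgebraicGeometry.Surjective φ ∧
      HuSmooth (ψ ≫ φ ≫ g) ∧ _root_.AlgebraicGeometry.Surjective ψ ∧ IsProper ψ ∧ IsBirational ψ

/-- **Hu 2025, p.3 L019–L020** — anchor alias `C03L19` of `AdmitsResolutionType` (chunk p0003
l.18–19: «In such a case, we say `X` admits a resolution of singularity type.»).
[claim: Hu2025, status: under-review]
STATUS: candidate statement under adjudication (D-0012/D-0089); not asserted. -/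
abbrev C03L19 {X S : Scheme.{u}} (g : X ⟶ S) : Prop := AdmitsResolutionType g

/-! ## §8 preamble (chunk p0067 l.3–8; PDF p.147 L048–L050) — the base field `𝔽` -/

/-- **Hu 2025, §8 preamble** (chunk p0067 l.3–8; PDF p.147 L048–L050), verbatim: «Let `p` be an arbitrarily fixed prime number.
Let `𝔽` be either `ℚ` or a finite field with `p` elements. In this entire section, every scheme is defined over `ℤ`,
consequently, is defined over `𝔽`, and is considered as a scheme over the perfect field `𝔽`.» (the same binder opens
Thm 1.3, chunk p0008 l.108–110; p.17). Typed as a PROPERTY of a field `𝔽` (PARTITION-HU §1/§6 (c): «`𝔽 = ℚ` or `𝔽_p`»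
is a hypothesis, never a comment): `𝔽 ≃+* ℚ` or `𝔽 ≃+* ℤ/pℤ` for some prime `p`. [claim: Hu2025, status: under-review]
STATUS: candidate statement under adjudication (D-0012/D-0089); not asserted. -/
def IsHuBaseField (𝔽 : Type u) [Field 𝔽] : Prop :=
  Nonempty (𝔽 ≃+* ℚ) ∨ ∃ p : ℕ, p.Prime ∧ Nonempty (𝔽 ≃+* ZMod p)

/-- **Hu 2025, §8 preamble** — anchor alias `C67L4` of `IsHuBaseField` (chunk p0067 l.4; PDF p.147 L048).
[claim: Hu2025, status: under-review]
STATUS: candidate statement under adjudication (D-0012/D-0089); not asserted. -/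
abbrev C67L4 (𝔽 : Type u) [Field 𝔽] : Prop := IsHuBaseField 𝔽

/-! ## «singular» — the hypothesis word of Thm 8.6 / Thm 1.3 / Thm 1.1 (never defined in print): two readings -/

/-- **«singular», READING R-sm** («not smooth over the base», dual to Def. 8.4's «smooth over `Spec 𝔽`»): for
`g : X ⟶ S`, `¬ Smooth g` (Mathlib, a property of the morphism). The texts (Thm 8.6 chunk p0071 l.88–89 «if `Z_Γ` is
singular»; Thm 1.3 chunk p0008 l.115–116 «provided that `Z_Γ` is singular»; Thm 1.1 chunk p0003 l.8) do not define
the word; sibling `HuSingular_reg`. A READING, labelled. [claim: Hu2025, status: under-review]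
STATUS: candidate statement under adjudication (D-0012/D-0089); not asserted. -/
def HuSingular {X S : Scheme.{u}} (g : X ⟶ S) : Prop :=
  ¬ _root_.AlgebraicGeometry.Smooth g

/-- **«singular», READING R-reg** («some local ring `𝒪_{X,x}` is not regular», the summit's vocabulary
`Resolution.Scheme.IsRegular`): `¬ IsRegular X`. Over a perfect field and for `X` locally of finite type the two
readings agree; no comparison is asserted here. [claim: Hu2025, status: under-review]
STATUS: candidate statement under adjudication (D-0012/D-0089); not asserted. -/
def HuSingular_reg (X : Scheme.{u}) : Prop :=
  ¬ Literature.AlgebraicGeometry.Resolution.Scheme.IsRegular X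


end Literature.AlgebraicGeometry.Hu2025.Statements.S08MainTheorem

end
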